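import Mathlib
import Literature.AlgebraicGeometry.Motives.VarietiesRegularProofs
import Literature.AlgebraicGeometry.Resolution.ExcellentRingsEssFiniteType
import HarnessLib

/-!
# [OURS · L0 W4.1] K3-a (part 1): the ÉTALE RESIDUE ENLARGEMENT of a local ring — `S ↦ T := (S[T]/(P))_𝔫`
# (chain W4.1 `FrobeniusClosingSteer`, crux stmt-ResolutionOfSingularities-16345; K3 = K-GG4 (c) `window_baseChange`, route (R1) of record,
# res-L0-w41-plan-1 RULINGs 221(a)/250(a); design `D/res-D-lib-1/K3-BLUEPRINT.md`; `--supports … --as helper`)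

HONEST FRAMING. OURS kernel (HIRONAKA-L librarian res-D-lib-1 gen 7). First brick of the base change that makes a non-rational window of the
quadratic-transform chain residually rational (target `K3Target.nonRationalWindow_free`, res-L0-w41-stub-2 `K3/K3_target_signature.lean`
ddf2b8c09338c95c). For a local ring `S`, a MONIC `P ∈ S[X]` whose reduction `P̄ ∈ κ(S)[X]` is SEPARABLE, and a root `θ` of `P̄` in a field
`k' ⊇ κ(S)` (`φ : κ(S) →+* k'`):

* `isUnit_mk_derivative` — `P′(x)` is a unit of `A := AdjoinRoot P = S[X]/(P)` (coprimality of `P̄, P̄′` lifted by Nakayama over the finite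
  free `S`-module `A`); `etale_adjoinRoot` — hence `A` is ÉTALE over `S` (Mathlib `StandardEtalePair` with `g = 1`);
* `kerLift` data: `𝔫 := ker (A → k', x ↦ θ)` is a maximal ideal over `𝔪_S` (`isMaximal_ker_lift`, `comap_ker_lift`);
* `T := Localization.AtPrime 𝔫`: `map_maximalIdeal_eq` (`𝔪_S T = 𝔪_T`, unramified), `isRegularLocalRing_localization_ker_lift`
  (regular if `S` is, tree `IsRegularLocalRing.of_etale`), `ringKrullDim_localization_ker_lift` (`dim T = dim S`, étale height preservation),
  `residue_surjective_of_ker_lift` (every element of `κ(T)` is the class of a polynomial in the root with coefficients from `S`).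

Mathematics: EGA IV 18.4 / Stacks 00UE–00TV (standard étale residue extensions); nothing here is a statement of H. Hironaka's manuscript
[Hironaka2017]. AI-written; AI review is weaker than expert review. [cite: StacksProject, Tag 00TV]
-/

set_option linter.dupNamespace false

noncomputable section

namespace Summit.ResolutionOfSingularities.ResolutionOfSingularities.Theorems.SwitchingDichotomy.EtaleLift

open IsLocalRing Polynomial

universe u

variable {S : Type u} [CommRing S]

/-! ## §1 `P′` is invertible modulo `P`; `S[X]/(P)` is étale -/

/-- Nakayama for units: in a module-finite algebra `A` over a local ring `S`, an element congruent to `1` modulo `𝔪_S A` is a unit.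
[folklore] -/
theorem isUnit_of_sub_one_mem_map [IsLocalRing S] {A : Type u} [CommRing A] [Algebra S A] [Module.Finite S A] (y : A)
    (hy : y - 1 ∈ (maximalIdeal S).map (algebraMap S A)) : IsUnit y := by
  -- `N := (y)` as an `S`-submodule; `⊤ ≤ N ⊔ 𝔪 • ⊤`, Nakayama gives `⊤ ≤ N`
  let N : Submodule S A := (Ideal.span {y}).restrictScalars S
  have htop : (⊤ : Submodule S A) ≤ N ⊔ (maximalIdeal S) • (⊤ : Submodule S A) := by
    intro a _
    have hsmul : (maximalIdeal S) • (⊤ : Submodule S A) = ((maximalIdeal S).map (algebraMap S A)).restrictScalars S := by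
      rw [Ideal.smul_top_eq_map]
    have h1 : a * y ∈ N := by
      change a * y ∈ Ideal.span {y}
      exact Ideal.mul_mem_left _ _ (Ideal.mem_span_singleton_self y)
    have h2 : a * (y - 1) ∈ (maximalIdeal S) • (⊤ : Submodule S A) := by
      rw [hsmul]
      exact Ideal.mul_mem_left _ _ hy
    have : a = a * y - a * (y - 1) := by ring
    rw [this]
    exact Submodule.sub_mem _ (Submodule.mem_sup_left h1) (Submodule.mem_sup_right h2)
  have hle : (⊤ : Submodule S A) ≤ N :=
    Submodule.le_of_le_smul_of_le_jacobson_bot Module.Finite.fg_top (maximalIdeal_le_jacobson _) htop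
  have h1 : (1 : A) ∈ Ideal.span {y} := hle Submodule.mem_top
  exact isUnit_of_dvd_one (Ideal.mem_span_singleton.mp h1)

/-- **`P′(x)` is a unit in `S[X]/(P)`** for `S` local, `P` monic and `P̄ ∈ κ(S)[X]` separable. [cite: StacksProject, Tag 00UE] -/
theorem isUnit_mk_derivative [IsLocalRing S] (P : S[X]) (hP : P.Monic) (hsep : (P.map (residue S)).Separable) :
    IsUnit (AdjoinRoot.mk P (derivative P)) := by
  haveI : Module.Finite S (AdjoinRoot P) := hP.finite_adjoinRoot
  -- coprimality downstairs: `ā P̄ + b̄ P̄′ = 1`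
  obtain ⟨a', b', hab⟩ := hsep
  obtain ⟨a, rfl⟩ := Polynomial.map_surjective (residue S) residue_surjective a'
  obtain ⟨b, rfl⟩ := Polynomial.map_surjective (residue S) residue_surjective b'
  rw [Polynomial.derivative_map, ← Polynomial.map_mul, ← Polynomial.map_mul, ← Polynomial.map_add] at hab
  -- `a P + b P′ - 1` has coefficients in `𝔪`
  have hcoeff : ∀ n, (a * P + b * derivative P - 1).coeff n ∈ maximalIdeal S := by
    intro n
    have := congrArg (fun q => q.coeff n) hab
    simp only [Polynomial.coeff_map] at this
    rw [← residue_eq_zero_iff, Polynomial.coeff_sub, map_sub, this]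
    simp [Polynomial.coeff_one]
  -- hence `mk (b P′) - 1 ∈ 𝔪 A`
  have hmem : AdjoinRoot.mk P (b * derivative P) - 1 ∈ (maximalIdeal S).map (algebraMap S (AdjoinRoot P)) := by
    have hq : AdjoinRoot.mk P (b * derivative P) - 1 = AdjoinRoot.mk P (a * P + b * derivative P - 1) := by
      rw [map_sub, map_add, map_one, map_mul (AdjoinRoot.mk P) a P, AdjoinRoot.mk_self, mul_zero, zero_add]
    have hq' : a * P + b * derivative P - 1 ∈ (maximalIdeal S).map (C : S →+* S[X]) :=
      Ideal.mem_map_C_iff.2 hcoeff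
    have := Ideal.mem_map_of_mem (AdjoinRoot.mk P) hq'
    rw [Ideal.map_map] at this
    rw [hq, AdjoinRoot.algebraMap_eq]
    exact this
  have hu := isUnit_of_sub_one_mem_map _ hmem
  rw [map_mul] at hu
  exact isUnit_of_mul_isUnit_right hu

/-- **`S[X]/(P)` is étale over `S`** for `S` local, `P` monic with separable reduction (a standard étale algebra with `g = 1`).
[cite: StacksProject, Tag 00UE] -/
theorem etale_adjoinRoot [IsLocalRing S] (P : S[X]) (hP : P.Monic) (hsep : (P.map (residue S)).Separable) :
    Algebra.Etale S (AdjoinRoot P) := by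
  obtain ⟨c, hc⟩ := (isUnit_mk_derivative P hP hsep).exists_right_inv
  obtain ⟨p₁, rfl⟩ := AdjoinRoot.mk_surjective c
  have hdvd : P ∣ derivative P * p₁ - 1 := by
    rw [← AdjoinRoot.mk_eq_zero, map_sub, map_one, map_mul, hc, sub_self]
  obtain ⟨r, hr⟩ := hdvd
  let Q : StandardEtalePair S :=
    { f := P, monic_f := hP, g := 1, cond := ⟨p₁, -r, 1, by rw [one_pow, mul_neg, ← hr]; ring⟩ }
  -- `Q.Ring ≃ₐ[S] (AdjoinRoot P)[1/1] ≃ₐ[S] AdjoinRoot P`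
  have h1 : AdjoinRoot.mk Q.f Q.g = 1 := by change AdjoinRoot.mk P 1 = 1; exact map_one _
  haveI : IsLocalization.Away (1 : AdjoinRoot P) (Localization.Away (AdjoinRoot.mk Q.f Q.g)) := by
    rw [h1]; infer_instance
  let e₁ : Q.Ring ≃ₐ[S] Localization.Away (AdjoinRoot.mk Q.f Q.g) := Q.equivAwayAdjoinRoot
  let e₂ : AdjoinRoot P ≃ₐ[AdjoinRoot P] Localization.Away (AdjoinRoot.mk Q.f Q.g) :=
    IsLocalization.atOne (AdjoinRoot P) (Localization.Away (AdjoinRoot.mk Q.f Q.g))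
  let e : Q.Ring ≃ₐ[S] AdjoinRoot P := e₁.trans (e₂.restrictScalars S).symm
  exact Algebra.Etale.of_equiv e

/-! ## §2 The prime `𝔫 = ker (S[X]/(P) → k', x ↦ θ)` and the local ring `T = (S[X]/(P))_𝔫` -/

section KerLift

variable [IsLocalRing S] (P : S[X]) {k' : Type u} [Field k'] (φ : ResidueField S →+* k') (θ : k')
  (hθ : P.eval₂ (φ.comp (residue S)) θ = 0)

/-- `𝔫 := ker (S[X]/(P) → k')` contracts to `𝔪_S`. [folklore] -/
theorem comap_ker_lift :
    (RingHom.ker (AdjoinRoot.lift (φ.comp (residue S)) θ hθ)).comap (algebraMap S (AdjoinRoot P)) = maximalIdeal S := by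
  ext s
  rw [Ideal.mem_comap, RingHom.mem_ker, AdjoinRoot.algebraMap_eq, AdjoinRoot.lift_of, RingHom.comp_apply,
    map_eq_zero_iff φ φ.injective, residue_eq_zero_iff]

/-- `𝔫` lies over `𝔪_S`. [folklore] -/
theorem under_ker_lift :
    (RingHom.ker (AdjoinRoot.lift (φ.comp (residue S)) θ hθ)).under S = maximalIdeal S :=
  comap_ker_lift P φ θ hθ

/-- `𝔫` is a maximal ideal of `S[X]/(P)` (`P` monic: the extension is integral and `𝔫 ∩ S = 𝔪_S` is maximal). [folklore] -/
theorem isMaximal_ker_lift (hP : P.Monic) :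
    (RingHom.ker (AdjoinRoot.lift (φ.comp (residue S)) θ hθ)).IsMaximal := by
  haveI : Module.Finite S (AdjoinRoot P) := hP.finite_adjoinRoot
  haveI : Algebra.IsIntegral S (AdjoinRoot P) := inferInstance
  haveI : (RingHom.ker (AdjoinRoot.lift (φ.comp (residue S)) θ hθ)).IsPrime := RingHom.ker_isPrime _
  refine Ideal.isMaximal_of_isIntegral_of_isMaximal_comap (R := S) _ ?_
  rw [comap_ker_lift]
  exact maximalIdeal.isMaximal S

/-- The local ring `T := (S[X]/(P))_𝔫` dominates `S`: `S → T` is a local homomorphism. [folklore] -/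
theorem isLocalHom_algebraMap_localization_ker_lift (hP : P.Monic) :
    haveI := isMaximal_ker_lift P φ θ hθ hP
    IsLocalHom (algebraMap S (Localization.AtPrime (RingHom.ker (AdjoinRoot.lift (φ.comp (residue S)) θ hθ)))) := by
  haveI := isMaximal_ker_lift P φ θ hθ hP
  set 𝔫 := RingHom.ker (AdjoinRoot.lift (φ.comp (residue S)) θ hθ)
  refine ⟨fun s hs => ?_⟩
  by_contra hns
  have hsm : s ∈ maximalIdeal S := hns
  rw [← comap_ker_lift P φ θ hθ, Ideal.mem_comap] at hsm
  have : algebraMap S (Localization.AtPrime 𝔫) s ∈ maximalIdeal (Localization.AtPrime 𝔫) := by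
    rw [IsScalarTower.algebraMap_apply S (AdjoinRoot P) (Localization.AtPrime 𝔫),
      ← Localization.AtPrime.map_eq_maximalIdeal]
    exact Ideal.mem_map_of_mem _ hsm
  exact (IsLocalRing.mem_maximalIdeal _).mp this hs

/-- **Unramified**: `𝔪_S T = 𝔪_T` for `T := (S[X]/(P))_𝔫` (`P` monic with separable reduction, so `S[X]/(P)` is étale).
[cite: StacksProject, Tag 00UW] -/
theorem map_maximalIdeal_localization_ker_lift (hP : P.Monic) (hsep : (P.map (residue S)).Separable) :
    haveI := isMaximal_ker_lift P φ θ hθ hP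
    (maximalIdeal S).map (algebraMap S (Localization.AtPrime (RingHom.ker (AdjoinRoot.lift (φ.comp (residue S)) θ hθ)))) =
      maximalIdeal (Localization.AtPrime (RingHom.ker (AdjoinRoot.lift (φ.comp (residue S)) θ hθ))) := by
  haveI := isMaximal_ker_lift P φ θ hθ hP
  haveI := etale_adjoinRoot P hP hsep
  set 𝔫 := RingHom.ker (AdjoinRoot.lift (φ.comp (residue S)) θ hθ)
  haveI : 𝔫.LiesOver (maximalIdeal S) := ⟨(under_ker_lift P φ θ hθ).symm⟩
  letI := Localization.AtPrime.algebraOfLiesOver (maximalIdeal S) 𝔫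
  have hunr : Algebra.IsUnramifiedAt S 𝔫 := inferInstance
  exact ((Algebra.isUnramifiedAt_iff_map_eq S (maximalIdeal S) 𝔫).1 hunr).2

/-- **Regularity**: `T := (S[X]/(P))_𝔫` is a regular local ring when `S` is (étale over regular; tree `IsRegularLocalRing.of_etale`).
[cite: StacksProject, Tag 00TV] -/
theorem isRegularLocalRing_localization_ker_lift (hreg : IsRegularLocalRing S) (hP : P.Monic)
    (hsep : (P.map (residue S)).Separable) :
    haveI := isMaximal_ker_lift P φ θ hθ hP
    IsRegularLocalRing (Localization.AtPrime (RingHom.ker (AdjoinRoot.lift (φ.comp (residue S)) θ hθ))) := by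
  haveI := isMaximal_ker_lift P φ θ hθ hP
  haveI := etale_adjoinRoot P hP hsep
  haveI := hreg
  set 𝔫 := RingHom.ker (AdjoinRoot.lift (φ.comp (residue S)) θ hθ)
  -- `S ≅ S_𝔪 = Localization.AtPrime (𝔫.under S)` is regular
  have hunits : ∀ x ∈ (𝔫.under S).primeCompl, IsUnit x := fun x hx => by
    have hx' : x ∉ maximalIdeal S := by rw [← under_ker_lift P φ θ hθ]; exact hx
    exact of_not_not fun h => hx' ((mem_maximalIdeal x).mpr (mem_nonunits_iff.mpr h))
  haveI : IsRegularLocalRing (Localization.AtPrime (𝔫.under S)) :=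
    IsRegularLocalRing.of_ringEquiv (IsLocalization.atUnits S (𝔫.under S).primeCompl hunits).toRingEquiv
  exact Literature.AlgebraicGeometry.Motives.IsRegularLocalRing.of_etale (R := S) 𝔫

/-- **Dimension**: `dim T = dim S` for `T := (S[X]/(P))_𝔫` (étale maps preserve heights, tree
`Ideal.height_eq_height_under_of_etale_of_isPrime`). [cite: StacksProject, Tag 00TV] -/
theorem ringKrullDim_localization_ker_lift [IsNoetherianRing S] (hP : P.Monic) (hsep : (P.map (residue S)).Separable) :
    haveI := isMaximal_ker_lift P φ θ hθ hP
    ringKrullDim (Localization.AtPrime (RingHom.ker (AdjoinRoot.lift (φ.comp (residue S)) θ hθ))) = ringKrullDim S := by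
  haveI := isMaximal_ker_lift P φ θ hθ hP
  haveI := etale_adjoinRoot P hP hsep
  set 𝔫 := RingHom.ker (AdjoinRoot.lift (φ.comp (residue S)) θ hθ)
  rw [IsLocalization.AtPrime.ringKrullDim_eq_height 𝔫 (Localization.AtPrime 𝔫),
    Literature.AlgebraicGeometry.Motives.Ideal.height_eq_height_under_of_etale_of_isPrime (R := S) 𝔫,
    under_ker_lift P φ θ hθ, IsLocalRing.maximalIdeal_height_eq_ringKrullDim]

/-- **Residue field**: every element of `κ(T)`, `T := (S[X]/(P))_𝔫`, is the residue of (the image of) an element of `S[X]/(P)` — i.e.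
`S[X]/(P) → κ(T)` is surjective (its kernel is the maximal ideal `𝔫`, so `κ(T) = (S[X]/(P))/𝔫 = κ(S)(θ)`). [folklore] -/
theorem residue_algebraMap_surjective (hP : P.Monic) :
    haveI := isMaximal_ker_lift P φ θ hθ hP
    Function.Surjective fun a : AdjoinRoot P =>
      residue (Localization.AtPrime (RingHom.ker (AdjoinRoot.lift (φ.comp (residue S)) θ hθ)))
        (algebraMap (AdjoinRoot P) _ a) := by
  haveI := isMaximal_ker_lift P φ θ hθ hP
  set 𝔫 := RingHom.ker (AdjoinRoot.lift (φ.comp (residue S)) θ hθ)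
  intro z
  obtain ⟨t, rfl⟩ := residue_surjective z
  obtain ⟨⟨a, s⟩, rfl⟩ := IsLocalization.mk'_surjective 𝔫.primeCompl t
  -- `s ∉ 𝔫`, `𝔫` maximal ⇒ `s * s' - 1 ∈ 𝔫` for some `s'`
  have hs : (s : AdjoinRoot P) ∉ 𝔫 := s.2
  obtain ⟨s', hs'⟩ : ∃ s' : AdjoinRoot P, (s : AdjoinRoot P) * s' - 1 ∈ 𝔫 := by
    have hunit : IsUnit (Ideal.Quotient.mk 𝔫 (s : AdjoinRoot P)) := by
      have hne : Ideal.Quotient.mk 𝔫 (s : AdjoinRoot P) ≠ 0 := by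
        rwa [Ne, Ideal.Quotient.eq_zero_iff_mem]
      letI := Ideal.Quotient.field 𝔫
      exact isUnit_iff_ne_zero.mpr hne
    obtain ⟨c, hc⟩ := hunit.exists_right_inv
    obtain ⟨s', rfl⟩ := Ideal.Quotient.mk_surjective c
    exact ⟨s', by rw [← Ideal.Quotient.eq_zero_iff_mem, map_sub, map_one, map_mul, hc, sub_self]⟩
  refine ⟨a * s', ?_⟩
  change residue _ (algebraMap _ _ (a * s')) = residue _ (IsLocalization.mk' _ a s)
  rw [← sub_eq_zero, ← map_sub, residue_eq_zero_iff, ← Localization.AtPrime.map_eq_maximalIdeal]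
  have hmk : algebraMap (AdjoinRoot P) (Localization.AtPrime 𝔫) (a * s') - IsLocalization.mk' (Localization.AtPrime 𝔫) a s =
      IsLocalization.mk' (Localization.AtPrime 𝔫) (a * ((s : AdjoinRoot P) * s' - 1)) s := by
    rw [eq_comm, IsLocalization.mk'_eq_iff_eq_mul, sub_mul, IsLocalization.mk'_spec, ← map_mul, ← map_sub]
    congr 1
    ring
  rw [hmk, IsLocalization.mk'_eq_mul_mk'_one]
  exact Ideal.mul_mem_right _ _ (Ideal.mem_map_of_mem _ (Ideal.mul_mem_left _ _ hs'))

end KerLift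

/-! ## §3 (APPEND, K3-a part 2): flatness, excellence, perfect residue field of `T := (S[X]/(P))_𝔫` -/

section KerLift2

variable [IsLocalRing S] (P : S[X]) {k' : Type u} [Field k'] (φ : ResidueField S →+* k') (θ : k')
  (hθ : P.eval₂ (φ.comp (residue S)) θ = 0)

/-- `T := (S[X]/(P))_𝔫` is FLAT over `S` (`S[X]/(P)` is free for `P` monic; localisation). [folklore] -/
theorem flat_localization_ker_lift (hP : P.Monic) :
    haveI := isMaximal_ker_lift P φ θ hθ hP
    Module.Flat S (Localization.AtPrime (RingHom.ker (AdjoinRoot.lift (φ.comp (residue S)) θ hθ))) := by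
  haveI := isMaximal_ker_lift P φ θ hθ hP
  set 𝔫 := RingHom.ker (AdjoinRoot.lift (φ.comp (residue S)) θ hθ)
  haveI : Module.Free S (AdjoinRoot P) := hP.free_adjoinRoot
  haveI : Module.Flat (AdjoinRoot P) (Localization.AtPrime 𝔫) := IsLocalization.flat _ 𝔫.primeCompl
  exact Module.Flat.trans S (AdjoinRoot P) (Localization.AtPrime 𝔫)

/-- `T := (S[X]/(P))_𝔫` is FAITHFULLY FLAT over `S` (flat + local homomorphism of local rings). [folklore] -/
theorem faithfullyFlat_localization_ker_lift (hP : P.Monic) :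
    haveI := isMaximal_ker_lift P φ θ hθ hP
    Module.FaithfullyFlat S (Localization.AtPrime (RingHom.ker (AdjoinRoot.lift (φ.comp (residue S)) θ hθ))) := by
  haveI := isMaximal_ker_lift P φ θ hθ hP
  haveI := flat_localization_ker_lift P φ θ hθ hP
  haveI := isLocalHom_algebraMap_localization_ker_lift P φ θ hθ hP
  exact Module.FaithfullyFlat.of_flat_of_isLocalHom

/-- `T := (S[X]/(P))_𝔫` is essentially of finite type over `S`. [folklore] -/
theorem essFiniteType_localization_ker_lift (hP : P.Monic) :
    haveI := isMaximal_ker_lift P φ θ hθ hP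
    Algebra.EssFiniteType S (Localization.AtPrime (RingHom.ker (AdjoinRoot.lift (φ.comp (residue S)) θ hθ))) := by
  haveI := isMaximal_ker_lift P φ θ hθ hP
  set 𝔫 := RingHom.ker (AdjoinRoot.lift (φ.comp (residue S)) θ hθ)
  haveI : Module.Finite S (AdjoinRoot P) := hP.finite_adjoinRoot
  haveI : Algebra.EssFiniteType S (AdjoinRoot P) :=
    Algebra.EssFiniteType.of_finiteType S (AdjoinRoot P)
  haveI : Algebra.EssFiniteType (AdjoinRoot P) (Localization.AtPrime 𝔫) :=
    Algebra.EssFiniteType.of_isLocalization _ 𝔫.primeCompl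
  exact Algebra.EssFiniteType.comp S (AdjoinRoot P) (Localization.AtPrime 𝔫)

/-- **Excellence**: `T := (S[X]/(P))_𝔫` is excellent when `S` is (essentially of finite type over an excellent ring; tree
`IsExcellentRing.of_essFiniteType`). [cite: Matsumura1987, §32 p. 260] -/
theorem isExcellentRing_localization_ker_lift (hP : P.Monic)
    (hexc : Literature.AlgebraicGeometry.Resolution.IsExcellentRing S) :
    haveI := isMaximal_ker_lift P φ θ hθ hP
    Literature.AlgebraicGeometry.Resolution.IsExcellentRing
      (Localization.AtPrime (RingHom.ker (AdjoinRoot.lift (φ.comp (residue S)) θ hθ))) := by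
  haveI := isMaximal_ker_lift P φ θ hθ hP
  exact hexc.of_essFiniteType (essFiniteType_localization_ker_lift P φ θ hθ hP)

/-- **Perfect residue field**: if `κ(S)` is perfect then so is `κ(T)`, `T := (S[X]/(P))_𝔫` — `κ(T)` is generated over the image of `S` by the
residue of the root, which is algebraic. [folklore] -/
theorem perfectField_residueField_localization_ker_lift (hP : P.Monic) [PerfectField (ResidueField S)] :
    haveI := isMaximal_ker_lift P φ θ hθ hP
    PerfectField (ResidueField (Localization.AtPrime (RingHom.ker (AdjoinRoot.lift (φ.comp (residue S)) θ hθ)))) := by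
  haveI := isMaximal_ker_lift P φ θ hθ hP
  set 𝔫 := RingHom.ker (AdjoinRoot.lift (φ.comp (residue S)) θ hθ)
  set T := Localization.AtPrime 𝔫
  haveI := isLocalHom_algebraMap_localization_ker_lift P φ θ hθ hP
  -- `κ(S) → κ(T)` and the factorisation `S[X]/(P) → κ(T)`
  letI : Algebra (ResidueField S) (ResidueField T) := (ResidueField.map (algebraMap S T)).toAlgebra
  -- every element of `κ(T)` is integral over `κ(S)`: it is the residue of some `a ∈ S[X]/(P)`, integral over `S`
  haveI : Module.Finite S (AdjoinRoot P) := hP.finite_adjoinRoot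
  have hint : Algebra.IsIntegral (ResidueField S) (ResidueField T) := by
    refine ⟨fun z => ?_⟩
    obtain ⟨a, rfl⟩ := residue_algebraMap_surjective P φ θ hθ hP z
    -- the composite `S → S[X]/(P) → T → κ(T)` equals `κ(S) → κ(T)` after `residue S`
    have ha : IsIntegral S a := Algebra.IsIntegral.isIntegral a
    obtain ⟨q, hqm, hq⟩ := ha
    refine ⟨q.map (residue S), hqm.map _, ?_⟩
    have hcomp : (algebraMap (ResidueField S) (ResidueField T)).comp (residue S) =
        (residue T).comp ((algebraMap (AdjoinRoot P) T).comp (algebraMap S (AdjoinRoot P))) := by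
      ext s
      change ResidueField.map (algebraMap S T) (residue S s) = residue T (algebraMap (AdjoinRoot P) T (algebraMap S _ s))
      rw [ResidueField.map_residue, ← IsScalarTower.algebraMap_apply]
    rw [Polynomial.eval₂_map, hcomp, ← Polynomial.hom_eval₂, ← Polynomial.hom_eval₂, hq, map_zero, map_zero]
  haveI : Algebra.IsAlgebraic (ResidueField S) (ResidueField T) := Algebra.IsIntegral.isAlgebraic
  exact Algebra.IsAlgebraic.perfectField (ResidueField S)

end KerLift2

end Summit.ResolutionOfSingularities.ResolutionOfSingularities.Theorems.SwitchingDichotomy.EtaleLift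

end
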